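import Mathlib

/-!
# The mixed three-point inequality (★) is FALSE — a kernel-checked five-vertex witness
(blind cell PercRepro2, p2; proofs/P2-G14-PAIRSPLIT.md §8, NEG-190)

Conditionally on `Q = {a₁ ↮ a₂}` let `L = C(a₁)`, `H = C(a₂)`.  The mixed three-point inequality
(★) of P2-G14-PAIRSPLIT.md §3 — the half (I5) of the pair form of row 2′BETA1 — reads, multiplied
out,

  `P(bL, oL, uH; Q)·P(Q)² + P(bL; Q)·P(oL; Q)·P(uH; Q) ≥ P(bL; Q)·P(oL, uH; Q)·P(Q) + P(oL; Q)·P(bL, uH; Q)·P(Q)`,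

i.e. `Cov_μ(1[b ∈ L], 1[u ∈ H]·(1[o ∈ L] − μ(o ∈ L))) ≥ 0` under `μ = P(· | Q)`.  It is FALSE: on the
five-vertex graph with edges `{0,1}, {0,2}, {1,3}, {1,4}, {2,3}, {2,4}, {3,4}` and weights
`1/2, 3/4, 19/20, 4/5, 9/10, 3/10, 17/20`, with `o = 1`, `a₁ = 0`, `a₂ = 3`, `b = 2`, `u = 4`, in units of
`1/1600000` (the product of the denominators `2·4·20·5·10·10·20`):

  `P(Q) = 246331`, `P(bL; Q) = 43491`, `P(oL; Q) = 3791`, `P(uH; Q) = 237370`,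
  `P(bL, oL, uH; Q) = 357`, `P(oL, uH; Q) = 2138`, `P(bL, uH; Q) = 40845`,

  `357·246331² + 43491·3791·237370 − 43491·2138·246331 − 3791·40845·246331 = −248889330396 < 0`.

Everything is a finite sum over the `2^7` edge configurations with integer weights
(`wt c = ∏_i (num_i if open else den_i − num_i)`); the seven masses are established by
`decide +kernel` (standard axioms only) and the inequality follows by `norm_num`.  The same
instance has `(I6) > 0` and the pair form `P_LH > 0` (P2-G14-PAIRSPLIT.md §8): the two halves of the
pair form cannot be proved separately.  Found by adversarial weight climbs (pmclimb_i5.c), exact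
on two codes (p2's Fractions code and the engine's D371).
-/

namespace Summit.Ventures.PercRepro2.MixedThreePointCounterexample

/-- An undirected edge `{u, v}` with weight `num / den`. -/
structure WEdge where
  u : Nat
  v : Nat
  num : Nat
  den : Nat

/-- The seven edges of the witness with their weights. -/
def edge : Nat → WEdge
  | 0 => ⟨0, 1, 1, 2⟩     -- {0, 1}, 1/2
  | 1 => ⟨0, 2, 3, 4⟩     -- {0, 2}, 3/4
  | 2 => ⟨1, 3, 19, 20⟩   -- {1, 3}, 19/20
  | 3 => ⟨1, 4, 4, 5⟩     -- {1, 4}, 4/5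
  | 4 => ⟨2, 3, 9, 10⟩    -- {2, 3}, 9/10
  | 5 => ⟨2, 4, 3, 10⟩    -- {2, 4}, 3/10
  | _ => ⟨3, 4, 17, 20⟩   -- {3, 4}, 17/20

/-- The marks: `o = 1`, `a₁ = 0`, `a₂ = 3`, `b = 2`, `u = 4`. -/
def o : Nat := 1
/-- The root `a₁ = 0` (its cluster is `L`). -/
def a₁ : Nat := 0
/-- The root `a₂ = 3` (its cluster is `H`). -/
def a₂ : Nat := 3
/-- The mark `b = 2`. -/
def b : Nat := 2
/-- The attachment vertex `u = 4`. -/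
def u : Nat := 4

/-- Edge `i` is open in the configuration `c ∈ [0, 2^7)` iff bit `i` of `c` is set. -/
def isOpen (c i : Nat) : Bool := c.testBit i

/-- Product Bernoulli weight of the configuration `c` in units of `1/1600000`:
`∏_i (num_i if open else den_i − num_i)`. -/
def wt (c : Nat) : Nat :=
  (List.range 7).foldl
    (fun acc i => acc * (if isOpen c i then (edge i).num else (edge i).den - (edge i).num)) 1

/-- Vertex sets are bitmasks over `0..4`; `mem S x` is `x ∈ S`. -/
def mem (S x : Nat) : Bool := S.testBit x

/-- One expansion step of a vertex set along the open (undirected) edges. -/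
def step (c S : Nat) : Nat :=
  (List.range 7).foldl (fun S i =>
    let e := edge i
    if isOpen c i then
      let S₁ := if mem S e.u then S ||| (1 <<< e.v) else S
      if mem S₁ e.v then S₁ ||| (1 <<< e.u) else S₁
    else S) S

/-- `n`-fold iteration of `step c`. -/
def iter (c : Nat) : Nat → Nat → Nat
  | 0, S => S
  | n + 1, S => iter c n (step c S)

/-- The open cluster of the vertex `v` (five steps suffice on five vertices). -/
def cluster (c v : Nat) : Nat := iter c 5 (1 <<< v)

/-- `Q = {a₁ ↮ a₂}`. -/
def Q (c : Nat) : Bool := !(mem (cluster c a₁) a₂)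
/-- `bL = {b ∈ C(a₁)}`. -/
def bL (c : Nat) : Bool := mem (cluster c a₁) b
/-- `oL = {o ∈ C(a₁)}`. -/
def oL (c : Nat) : Bool := mem (cluster c a₁) o
/-- `uH = {u ∈ C(a₂)}`. -/
def uH (c : Nat) : Bool := mem (cluster c a₂) u

/-- `1600000 · P(Q)`. -/
def massQ : Nat := (List.range 128).foldl (fun a c => if Q c then a + wt c else a) 0
/-- `1600000 · P(bL; Q)`. -/
def massB : Nat := (List.range 128).foldl (fun a c => if Q c && bL c then a + wt c else a) 0
/-- `1600000 · P(oL; Q)`. -/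
def massO : Nat := (List.range 128).foldl (fun a c => if Q c && oL c then a + wt c else a) 0
/-- `1600000 · P(uH; Q)`. -/
def massU : Nat := (List.range 128).foldl (fun a c => if Q c && uH c then a + wt c else a) 0
/-- `1600000 · P(bL, oL, uH; Q)`. -/
def massBOU : Nat :=
  (List.range 128).foldl (fun a c => if Q c && bL c && oL c && uH c then a + wt c else a) 0
/-- `1600000 · P(oL, uH; Q)`. -/
def massOU : Nat :=
  (List.range 128).foldl (fun a c => if Q c && oL c && uH c then a + wt c else a) 0
/-- `1600000 · P(bL, uH; Q)`. -/
def massBU : Nat :=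
  (List.range 128).foldl (fun a c => if Q c && bL c && uH c then a + wt c else a) 0

/-- Total mass `1600000` (sanity: the weights sum to one). -/
theorem total_mass : (List.range 128).foldl (fun a c => a + wt c) 0 = 1600000 := by
  decide +kernel

/-- `1600000 · P(Q) = 246331`. -/
theorem massQ_eq : massQ = 246331 := by decide +kernel
/-- `1600000 · P(bL; Q) = 43491`. -/
theorem massB_eq : massB = 43491 := by decide +kernel
/-- `1600000 · P(oL; Q) = 3791`. -/
theorem massO_eq : massO = 3791 := by decide +kernel
/-- `1600000 · P(uH; Q) = 237370`. -/
theorem massU_eq : massU = 237370 := by decide +kernel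
/-- `1600000 · P(bL, oL, uH; Q) = 357`. -/
theorem massBOU_eq : massBOU = 357 := by decide +kernel
/-- `1600000 · P(oL, uH; Q) = 2138`. -/
theorem massOU_eq : massOU = 2138 := by decide +kernel
/-- `1600000 · P(bL, uH; Q) = 40845`. -/
theorem massBU_eq : massBU = 40845 := by decide +kernel

/-- The multiplied-out (★) form on this instance is `−248889330396 < 0` (in units of
`1600000⁻³`). -/
theorem star_value :
    (massBOU : ℤ) * massQ * massQ + massB * massO * massU - massB * massOU * massQ
        - massO * massBU * massQ = -248889330396 := by
  rw [massQ_eq, massB_eq, massO_eq, massU_eq, massBOU_eq, massOU_eq, massBU_eq]; norm_num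

/-- **(★) FAILS**: `P(bL, oL, uH; Q)·P(Q)² + P(bL; Q)·P(oL; Q)·P(uH; Q) <
P(bL; Q)·P(oL, uH; Q)·P(Q) + P(oL; Q)·P(bL, uH; Q)·P(Q)`, i.e.
`Cov_μ(1[b ∈ L], 1[u ∈ H]·(1[o ∈ L] − μ(o ∈ L))) < 0` on this instance. -/
theorem mixed_three_point_false :
    (massBOU : ℚ) / 1600000 * (massQ / 1600000) * (massQ / 1600000) +
        (massB / 1600000) * (massO / 1600000) * (massU / 1600000) <
      (massB / 1600000) * (massOU / 1600000) * (massQ / 1600000) +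
        (massO / 1600000) * (massBU / 1600000) * (massQ / 1600000) := by
  rw [massQ_eq, massB_eq, massO_eq, massU_eq, massBOU_eq, massOU_eq, massBU_eq]; norm_num

/-- The conditional covariance itself: `Cov_μ(1_{bL}, 1_{uH}(1_{oL} − μ(oL))) =
−248889330396 / 14947109280282691`. -/
theorem covariance_value :
    (massBOU : ℚ) / massQ - (massO / massQ) * (massBU / massQ)
        - (massB / massQ) * (massOU / massQ - (massO / massQ) * (massU / massQ)) =
      -248889330396 / 14947109280282691 := by
  rw [massQ_eq, massB_eq, massO_eq, massU_eq, massBOU_eq, massOU_eq, massBU_eq]; norm_num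

end Summit.Ventures.PercRepro2.MixedThreePointCounterexample
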